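import Summits.QuantumFields.YangMills.Theorems.BalabanUVNodesN11TkFullBondTransportIntegrable
import Literature.MathematicalPhysics.QuantumFieldTheory.Balaban1983to89.Node00.TkNoExpansionStepSucc

/-!
# DAG node N11 — THE LEVEL-(k+1) NO-EXPANSION SLOT AS A SUM OF TRANSPORTS UNDER GRAPH-INTEGRABILITY (this seat's g3 lemma p485389 with the sup bound on the
# new integrands replaced by integrability along the averaging graph), and the A.E. ADDITIVITY of def-T's transport of record over finite sums of graph-integrable
# integrands — step two of re-typing the analytic binder `hC`∕`hCB` of the no-expansion 𝐓-step

WHY.  Step two of re-typing the analytic binder of dag-n11-d's no-expansion 𝐓-step (see `…N11TkFullBondTransportIntegrable`): g3's lemma «the level-(k+1)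
no-expansion slot is a.e. the SUM over the old index of def-T's transports of the new integrands» (p485389) and the additivity of def-T's transport over that
sum both asked for a sup bound; graph-integrability suffices — additivity then holds ALMOST EVERYWHERE (the sections are kernel-integrable for a.e. coarse field
off the null set of the marginal density, by disintegration of the joint law).

WHAT THIS FILE PROVES (0 `sorry`, 0 `def`; `N`-generic).  §1 `ae_integrable_section_of_integrable_graph` (Mathlib `Integrable.condKernel_ae` + `withDensity_margDensity` +
`ae_withDensity_iff`), `transportOfRecord_eq_zero_of_margDensity_eq_zero`, ★ `transportOfRecord_finset_sum_ae`.  §2 ★★ `TkOfRecord_succ_ae_eq_sum_transportOfRecord_of_Omega_empty_of_integrable`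
(g3's p485389 with `hC` replaced by `hI : ∀ S ∈ admS k (init s′), Integrable (U₀ ↦ newIntegrand_S(Ū₀, U₀))`).  Sources: [III] (2.21)–(2.22) p. 258, (3.1) p. 264,
(3.24)–(3.25) p. 270; [Balaban1985Averaging] (10) p. 19.

HONEST SCOPE.  Helper lane of K1⁷ `stmt-QuantumFields-20542` (dag-n11-d g9); [folklore] measure theory (disintegration along Bałaban's averaging of record, `HaarAC`) over the
tree's OWN kernels and records; nothing of Bałaban's estimates is asserted; no binder of an ACCEPTED theorem is edited (new `_of_integrable` theorems stand beside the
bounded ones); director-ym №186 (1) respected (no value law for `Zh` at `k ≥ 1` is posited).  N11 is NOT discharged; counts unmoved (typed 28∕28 · discharged 5∕27).  One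
finite four-torus programme at fixed `ε = L^{−K}`; NOT ℝ⁴, NOT OS, NOT a mass gap, NOT Clay.
-/

noncomputable section

open MeasureTheory
open scoped ENNReal

namespace Summit.QuantumFields.YangMills.Theorems.BalabanUVNodesN11TkNoExpansionSumTransportIntegrable

open Literature.MathematicalPhysics.QuantumFieldTheory.Balaban1983to89 T4Continuum T4FiniteEpsInhabited Node00 Node00.Tk
open T4AveragingDisintegration (kernelTransport margDensity condLaw jointLaw avgKernel measurable_margDensity integrable_jointLaw_iff withDensity_margDensity)
open BalabanUVNodesN11TkFullBondTransportIntegrable (kernelRTOfRecord_full_ae_eq_transportOfRecord_of_integrable)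

variable (F : T4Family) (N : ℕ) [NeZero N]

/-! ## §1  Graph-integrability ⇒ kernel-integrable sections for a.e. coarse field off the null set of the marginal density -/

/-- **A GRAPH-INTEGRABLE JOINTLY MEASURABLE INTEGRAND FAMILY HAS KERNEL-INTEGRABLE SECTIONS FOR `dV′`-A.E. `V′` WITH POSITIVE MARGINAL DENSITY** (`k < K`):
disintegration of the joint law (`Integrable.condKernel_ae`) gives the sections `(Ū_* dU)`-a.e., and `Ū_* dU = h·dV′` (`withDensity_margDensity`, `ae_withDensity_iff`).
[cite: Balaban1985Averaging, (10) p.19 (bookkeeping)] -/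
theorem ae_integrable_section_of_integrable_graph (K k : ℕ) (hk : k < K)
    {f : GaugeField (F.P K) (k + 1) (SU N) → GaugeField (F.P K) k (SU N) → ℝ} (hm : Measurable (Function.uncurry f))
    (hI : Integrable (fun U => f ((avOfRecord F N K k).avg U) U) (fieldMeasure (F.P K) k (SU N))) :
    ∀ᵐ V' ∂fieldMeasure (F.P K) (k + 1) (SU N),
      margDensity (fieldMeasure (F.P K) k (SU N)) (fieldMeasure (F.P K) (k + 1) (SU N)) (avOfRecord F N K k).avg V' ≠ 0 →
        Integrable (f V') (avgKernel (avOfRecord F N K k).avg V') := by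
  set μ := fieldMeasure (F.P K) k (SU N)
  set μ' := fieldMeasure (F.P K) (k + 1) (SU N)
  set av := (avOfRecord F N K k).avg
  have hmav : Measurable av := avOfRecord_measurable F N K k
  have hac : μ.map av ≪ μ' := avOfRecord_haarAC F N K k hk
  have hgi : Integrable (Function.uncurry f) (jointLaw μ av) := (integrable_jointLaw_iff μ hmav hm.aestronglyMeasurable).2 hI
  have h1 : ∀ᵐ V' ∂(jointLaw μ av).fst, Integrable (fun U => Function.uncurry f (V', U)) ((jointLaw μ av).condKernel V') := hgi.condKernel_ae
  have hfst : (jointLaw μ av).fst = μ'.withDensity (fun V => (margDensity μ μ' av V : ℝ≥0∞)) := by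
    rw [T4AveragingDisintegration.jointLaw_fst μ hmav, withDensity_margDensity μ μ' hmav hac]
  rw [hfst, ae_withDensity_iff measurable_margDensity.coe_nnreal_ennreal] at h1
  filter_upwards [h1] with V' hV' hne
  exact hV' (by exact_mod_cast hne)

/-- **def-T's TRANSPORT OF RECORD VANISHES WHERE THE MARGINAL DENSITY DOES** (it carries the factor `h(V′)`), whatever the integrand. [cite: Balaban1988Convergent, (3.1) p.264 (bookkeeping)] -/
theorem transportOfRecord_eq_zero_of_margDensity_eq_zero (K k : ℕ) (g : GaugeField (F.P K) k (SU N) → ℝ) (V' : GaugeField (F.P K) (k + 1) (SU N))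
    (h0 : margDensity (fieldMeasure (F.P K) k (SU N)) (fieldMeasure (F.P K) (k + 1) (SU N)) (avOfRecord F N K k).avg V' = 0) :
    transportOfRecord F N K k g V' = 0 := by
  show kernelTransport _ _ _ g V' = 0
  simp only [kernelTransport, h0, NNReal.coe_zero, zero_mul]

/-- **★ def-T's TRANSPORT OF RECORD IS ADDITIVE OVER FINITE SUMS, A.E., FOR GRAPH-INTEGRABLE JOINTLY MEASURABLE INTEGRAND FAMILIES** (`k < K`): where `h(V′) = 0`
both sides vanish; elsewhere the sections are kernel-integrable for a.e. `V′` (§1) and `integral_finset_sum` applies. [cite: Balaban1988Convergent, (3.1) p.264 (bookkeeping)] -/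
theorem transportOfRecord_finset_sum_ae (K k : ℕ) (hk : k < K) {ι : Type*} (S : Finset ι)
    (f : ι → GaugeField (F.P K) (k + 1) (SU N) → GaugeField (F.P K) k (SU N) → ℝ) (hm : ∀ i ∈ S, Measurable (Function.uncurry (f i)))
    (hI : ∀ i ∈ S, Integrable (fun U => f i ((avOfRecord F N K k).avg U) U) (fieldMeasure (F.P K) k (SU N))) :
    ∀ᵐ V' ∂fieldMeasure (F.P K) (k + 1) (SU N),
      transportOfRecord F N K k (fun U => ∑ i ∈ S, f i V' U) V' = ∑ i ∈ S, transportOfRecord F N K k (f i V') V' := by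
  have hall := (Filter.eventually_all_finset S).2 fun i hi => ae_integrable_section_of_integrable_graph F N K k hk (hm i hi) (hI i hi)
  filter_upwards [hall] with V' hV'
  by_cases h0 : margDensity (fieldMeasure (F.P K) k (SU N)) (fieldMeasure (F.P K) (k + 1) (SU N)) (avOfRecord F N K k).avg V' = 0
  · rw [transportOfRecord_eq_zero_of_margDensity_eq_zero F N K k _ V' h0]
    exact (Finset.sum_eq_zero fun i _ => transportOfRecord_eq_zero_of_margDensity_eq_zero F N K k _ V' h0).symm
  · show kernelTransport _ _ _ (fun U => ∑ i ∈ S, f i V' U) V' = ∑ i ∈ S, kernelTransport _ _ _ (f i V') V'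
    simp only [kernelTransport]
    rw [integral_finsetSum S (fun i hi => hV' i hi h0), Finset.mul_sum]

/-! ## §2  The level-(k+1) no-expansion slot: the sum over the old index of the transports of the new integrands, a.e., under graph-integrability -/

variable {F N}

/-- **★ THE A.E. FACE OF THE LEVEL-(k+1) NO-EXPANSION SLOT, GRAPH-INTEGRABLE FORM** (g3's `TkOfRecord_succ_ae_eq_sum_transportOfRecord_of_Omega_empty` with the sup
bound on the new integrands per old branch replaced by their integrability along the averaging graph): for `k < K`, `Ω_{k+1}(s′) = ∅`, jointly measurable new
integrands whose graph restrictions `U₀ ↦ (new integrand)(Ū₀, U₀)` are `dU₀`-integrable, `𝐓_{k+1}(s′)Φ` IS the sum over the old index of def-T's one-step transports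
of the new integrands, `dV′`-a.e. [cite: Balaban1988Convergent, (2.21)–(2.22) p.258, (3.1) p.264, (3.24)–(3.25) p.270] -/
theorem TkOfRecord_succ_ae_eq_sum_transportOfRecord_of_Omega_empty_of_integrable {V : Type} [NormedAddCommGroup V] [InnerProductSpace ℝ V]
    [FiniteDimensional ℝ V] [MeasurableSpace V] [BorelSpace V] (ν : Stage7Numerics) (M : ℕ) (g : ℕ → ℝ) (K : ℕ) (W : TkWeights F N V K)
    {k : ℕ} (hk : k < K) (s : SeqOfRecord F ν M g K (k + 1)) (hΩ : s.Ω (k + 1) = ∅)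
    (Φ : SFluct (F.P K) V → B15DeterminingSets.MSField (F.P K) (SU N) → ℝ)
    (hm : ∀ S ∈ admSOfRecord F ν M g K k s.init, Measurable (Function.uncurry (noExpIntegrandAt F N V K k W
      (tkBranchOfRecord F N V ν M g K W s.init S k (fun ω => Φ (S, fun j => (ω j).2) (fun j => (ω j).1))))))
    (hI : ∀ S ∈ admSOfRecord F ν M g K k s.init, Integrable (fun U₀ : GaugeField (F.P K) k (SU N) => noExpIntegrandAt F N V K k W
      (tkBranchOfRecord F N V ν M g K W s.init S k (fun ω => Φ (S, fun j => (ω j).2) (fun j => (ω j).1))) ((avOfRecord F N K k).avg U₀) U₀)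
      (fieldMeasure (F.P K) k (SU N))) :
    TkOfRecord F N V ν M g K W (k + 1) s Φ =ᵐ[fieldMeasure (F.P K) (k + 1) (SU N)]
      fun V' => ∑ S ∈ admSOfRecord F ν M g K k s.init, transportOfRecord F N K k (noExpIntegrandAt F N V K k W
        (tkBranchOfRecord F N V ν M g K W s.init S k (fun ω => Φ (S, fun j => (ω j).2) (fun j => (ω j).1))) V') V' := by
  classical
  set D := genDataOfRecord F N V ν M g K W s (fun _ => ∅) k with hD
  have hV : ∀ b, b ∈ D.sV := mem_sV_of_Omega_empty V ν M g K W s (fun _ => ∅) k hΩ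
  have hV' : ∀ b, b ∈ D.sV' := mem_sV'_of_Omega_empty V ν M g K W s (fun _ => ∅) k hΩ
  have hface : ∀ S ∈ admSOfRecord F ν M g K k s.init,
      (fun V' : GaugeField (F.P K) (k + 1) (SU N) => kernelRTOfRecord F N K k D.sV D.sV'
        (fun y => noExpIntegrandAt F N V K k W
          (tkBranchOfRecord F N V ν M g K W s.init S k (fun ω => Φ (S, fun j => (ω j).2) (fun j => (ω j).1))) V'
          (Function.updateFinset (fun _ => 1) D.sV y)) (fun b => V' b)) =ᵐ[fieldMeasure (F.P K) (k + 1) (SU N)]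
      fun V' => transportOfRecord F N K k (noExpIntegrandAt F N V K k W
        (tkBranchOfRecord F N V ν M g K W s.init S k (fun ω => Φ (S, fun j => (ω j).2) (fun j => (ω j).1))) V') V' := by
    intro S hS
    have hmf : Measurable (Function.uncurry fun (V' : GaugeField (F.P K) (k + 1) (SU N)) (y : ↥D.sV → SU N) =>
        noExpIntegrandAt F N V K k W
          (tkBranchOfRecord F N V ν M g K W s.init S k (fun ω => Φ (S, fun j => (ω j).2) (fun j => (ω j).1))) V'
          (Function.updateFinset (fun _ => 1) D.sV y)) :=
      (hm S hS).comp (measurable_fst.prodMk (measurable_updateFinset.comp measurable_snd))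
    have hIf : Integrable (fun U₀ : GaugeField (F.P K) k (SU N) => noExpIntegrandAt F N V K k W
        (tkBranchOfRecord F N V ν M g K W s.init S k (fun ω => Φ (S, fun j => (ω j).2) (fun j => (ω j).1))) ((avOfRecord F N K k).avg U₀)
        (Function.updateFinset (fun _ => 1) D.sV (fun b : ↥D.sV => U₀ b))) (fieldMeasure (F.P K) k (SU N)) := by
      refine (hI S hS).congr (ae_of_all _ fun U₀ => ?_)
      simp only [updateFinset_one_restrict_of_forall_mem hV]
    have h := kernelRTOfRecord_full_ae_eq_transportOfRecord_of_integrable F N K k hk (hdec := inferInstance) D.sV hV D.sV' hV' _ hmf hIf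
    filter_upwards [h] with V' h1
    rw [h1]
    simp only [updateFinset_one_restrict_of_forall_mem hV]
  have hall := (Filter.eventually_all_finset (admSOfRecord F ν M g K k s.init)).2 hface
  filter_upwards [hall] with V' hV'S
  rw [TkOfRecord_succ_eq_sum_kernelRT_of_Omega_empty ν M g K W s hΩ Φ V']
  exact Finset.sum_congr rfl fun S hS => hV'S S hS

end Summit.QuantumFields.YangMills.Theorems.BalabanUVNodesN11TkNoExpansionSumTransportIntegrable

end
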